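import Summits.QuantumFields.YangMills.Theorems.UnitScaleGibbsWordTwoElitzur
import Summits.QuantumFields.YangMills.Theorems.UnitScaleGibbsElitzurOrthogonality
import HarnessLib

/-!
# Elitzur orthogonality for `word₂`, sequel: compact matrix models (the integrability row discharged), fixed-colour invariance of the
# Schwinger–Dyson observables, and the `2 × 2` DIAGONAL MASS IDENTITY `word₂ p i i = −det(u_b)·ρ(U(∂p))`

Cell `ym3-torus` (rung R3 = continuum SU(2) Yang–Mills on T³ — NOT d = 4, NOT infinite volume, NOT a mass gap, NOT Clay); width seat `ym3-torus-px17` gen 7; row (E2)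
of the split with `ym-ust-19936-w8` g10 (w8: (Q) quaternion twirl, (E0)/(G) engine, (E1) single insertions; px17: (E2) double insertions), sequel of
✓/⧗ `UnitScaleGibbsWordTwoElitzur`.  For the repair of LINE 28 «GrossTransfer» (`stub_linTest`, stmt-QuantumFields-23083): w8's accounting of the GLOBAL Coulomb
test field needs (a) `E[tr word₂ p i l] = 0` for insertions at distinct vertices — §2 here, for every compact matrix model and every finite twirl family killing
traceless letters (for `SU(2)`: `1, q₁, q₂, q₃`, w8's (Q)) — and (b) the DIAGONAL terms as an exact 1-form MASS: §3, `tr word₂ p i i = −det(u_{b_i})·tr ρ(U(∂p))` for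
traceless `2 × 2` letters (Cayley–Hamilton), so `E[actionDeriv₂]` in a raw region is `Σ_b (mass of u_b)·E[plaquette traces] +` the same-vertex corner terms `{0,3}`.
§1 also records the FIXED-COLOUR invariance `(∂_u A)(U^v) = (∂_u A)(U)` whenever every `v(x)` commutes with every letter (w7 g16's hand verification, 19:28Z:
«for ANY gauge transformation κ, Y_u(W^κ) = Y_{Ad(κ⁻¹)u}(W) … = Y_u(W) when u = u⁰ ⊗ τ_α and κ ∈ exp(ℝτ_α)» — the letter that lets the global test field live on
tree bonds in the dressed Schwinger–Dyson identity).

WHAT IS PROVED (ns `…Theorems.UnitScaleGibbsWordTwoElitzurSU2`; THEOREMS ONLY, 0 `def`, 0 `sorry`):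
* §1 `actionDeriv_gaugeAct_of_comm`, `actionDeriv₂_gaugeAct_of_comm` (fixed colour); `integrable_re_trace_word₂` (compact second-countable `G`, continuous `ρ`).
* §2 ★★★ `integral_re_trace_word₂_eq_zero` — (E2) with the integrability row discharged; ★★ `su_integral_re_trace_word₂_eq_zero` — the `SU(N)` reading
  (`fundamentalRep`), twirl family displayed (`g : Fin n → SU(N)`, `Σ_k (g k)⁻¹ X (g k) = 0` on the slot-`i` letter; for `N = 2` w8's (Q) supplies it from `tr X = 0`).
* §3 `mul_self_eq_neg_det_smul` (`X² = −det X·1` for traceless `2 × 2`), `slotIns₂_eq_smul`, `word_update_smul_self`, ★★ `word₂_diag_eq_smul`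
  (`word₂ ρ u U p i i = (−det u_{b_i}) • ρ(U(∂p))`), ★ `trace_word₂_diag`.
* §4 ★★★ `su2_integral_re_trace_word₂_eq_zero` — (E2) for `SU(2)` lattice Yang–Mills, hypothesis-free but for `tr u_{b_i} = 0` and distinct vertices: the twirl
  family `1, 𝐢, 𝐣, 𝐤` and w8's (Q) ✓ `UnitScaleGibbsElitzurOrthogonality.pauli_twirl_eq_zero` discharge `htw`.

HONEST SCOPE.  Exact identities; helper rows for a redesign not yet registered; nothing of `stub_linTest`, 23083, K1, `HistoryTailL` or any rung is proved; the
Yang–Mills mass gap is NOT proved.  `--supports stmt-QuantumFields-23083 --as helper`.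
References: S. Elitzur, Phys. Rev. D 12 (1975) 3978 [Elitzur1975]; M. Creutz, Quarks, gluons and lattices, Ch. 9, 11 [Creutz2022]; L. Gross, CMP 92 (1983) Thm 2.2 [GrossCMP1983].
-/

set_option autoImplicit false

noncomputable section
open MeasureTheory Filter Topology
open scoped BigOperators
open Literature.MathematicalPhysics.QuantumFieldTheory.Balaban1983to89
open Literature.MathematicalPhysics.QuantumFieldTheory.Balaban1983to89.T4GenFunBounds (gibbsMeasure isProbabilityMeasure_gibbsMeasure)
open Literature.MathematicalPhysics.QuantumLattice (fundamentalRep fundamentalRep_mem_unitaryGroup continuous_fundamentalRep)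
open Summit.QuantumFields.YangMills.Theorems.EquipartitionPinsProbe.TangentSteinFiniteBeta (exists_abs_le_of_continuous)
open Summit.QuantumFields.YangMills.Theorems.UnitScaleGibbsActionDerivativeSlotCalculus
open Summit.QuantumFields.YangMills.Theorems.UnitScaleGibbsWordTwoElitzur

namespace Summit.QuantumFields.YangMills.Theorems.UnitScaleGibbsWordTwoElitzurSU2

/-! ## §1 Fixed-colour invariance; integrability of the double-insertion traces on compact matrix models -/

section FixedColour

variable {N : ℕ} {P : Params} {j : ℕ} {G : Type} [GaugeGroup G]
  (ρ : G →* Matrix (Fin N) (Fin N) ℂ) (u : PBond P j → Matrix (Fin N) (Fin N) ℂ) (v : GaugeTransf P j G)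

/-- ★ **Fixed colour**: if every `ρ(v(b₋))` commutes with the letter `u_b`, the Schwinger–Dyson observable is gauge INVARIANT, `(∂_u A)(U^v) = (∂_u A)(U)`.
[cite: GrossCMP1983, Thm 2.2 (proof)] -/
theorem actionDeriv_gaugeAct_of_comm (h : ∀ b, ρ (v b.src) * u b = u b * ρ (v b.src)) (U : GaugeField P j G) :
    actionDeriv ρ u (GaugeField.gaugeAct v U) = actionDeriv ρ u U := by
  rw [actionDeriv_gaugeAct]
  congr 1
  funext b
  rw [mul_assoc, ← h b, ← mul_assoc, ← map_mul, inv_mul_cancel, map_one, one_mul]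

/-- ★ **Fixed colour, Hessian**: `(∂_u∂_u A)(U^v) = (∂_u∂_u A)(U)` under the same commutation. [cite: GrossCMP1983, Thm 2.2 (proof)] -/
theorem actionDeriv₂_gaugeAct_of_comm (h : ∀ b, ρ (v b.src) * u b = u b * ρ (v b.src)) (U : GaugeField P j G) :
    actionDeriv₂ ρ u (GaugeField.gaugeAct v U) = actionDeriv₂ ρ u U := by
  rw [actionDeriv₂_gaugeAct]
  congr 1
  funext b
  rw [mul_assoc, ← h b, ← mul_assoc, ← map_mul, inv_mul_cancel, map_one, one_mul]

end FixedColour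

section Compact

variable {N : ℕ} {P : Params} {G : Type} [GaugeGroup G]
  [TopologicalSpace G] [IsTopologicalGroup G] [CompactSpace G] [MeasurableSpace G] [BorelSpace G] [SecondCountableTopology G]
  [RegularGaugeGroup G] [HaarData G]
  {ρ : G →* Matrix (Fin N) (Fin N) ℂ} (hρ : Continuous ρ) (u : PBond P 0 → Matrix (Fin N) (Fin N) ℂ)

include hρ

/-- On a compact (second-countable) group with a continuous matrix model, `U ↦ Re tr word₂ ρ u U p i l` is continuous and bounded, hence integrable for the
probability measure `μ_β`, `β ≥ 0`. [folklore] -/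
theorem integrable_re_trace_word₂ {β : ℝ} (hβ : 0 ≤ β) (p : Plaq P 0) (i l : Fin 4) :
    Integrable (fun U : GaugeField P 0 G => (word₂ ρ u U p i l).trace.re) (gibbsMeasure P β) := by
  haveI : CompactSpace (GaugeField P 0 G) := inferInstanceAs (CompactSpace (PBond P 0 → G))
  haveI : OpensMeasurableSpace (GaugeField P 0 G) := inferInstanceAs (OpensMeasurableSpace (PBond P 0 → G))
  haveI := isProbabilityMeasure_gibbsMeasure (G := G) P hβ
  have hc : Continuous fun U : GaugeField P 0 G => (word₂ ρ u U p i l).trace.re :=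
    Complex.continuous_re.comp (continuous_word₂ hρ u p i l).matrix_trace
  obtain ⟨C, -, hC⟩ := exists_abs_le_of_continuous hc
  exact Integrable.of_bound hc.measurable.aestronglyMeasurable C (ae_of_all _ fun U => by rw [Real.norm_eq_abs]; exact hC U)

/-! ## §2 (E2) on compact matrix models and for `SU(N)` -/

/-- ★★★ **ELITZUR ORTHOGONALITY FOR `word₂` (compact matrix model)**: `β ≥ 0`, slots `i, l` with distinct insertion vertices, and a finite family `g : Fin n → G`
(`n ≠ 0`) conjugation by which kills the slot-`i` letter ⇒ `∫ Re tr(word₂ ρ u U p i l) dμ_β = 0`. [cite: Elitzur1975, §II] -/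
theorem integral_re_trace_word₂_eq_zero {β : ℝ} (hβ : 0 ≤ β) {n : ℕ} (hn : n ≠ 0) (g : Fin n → G) (p : Plaq P 0) (i l : Fin 4)
    (hil : (slotBond p i).src ≠ (slotBond p l).src) (htw : ∑ k, ρ (g k)⁻¹ * u (slotBond p i) * ρ (g k) = 0) :
    ∫ U, (word₂ ρ u U p i l).trace.re ∂gibbsMeasure P β = 0 :=
  integral_re_trace_word₂_eq_zero_of_twirl ρ hβ hn g u p i l hil htw (integrable_re_trace_word₂ hρ u hβ p i l)

end Compact

section SUN

variable {N : ℕ} [NeZero N] {P : Params}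

omit [NeZero N] in
/-- `SU(N) ⊂ M_N(ℂ)` is second countable (local copy; the Literature twin lives in a Barriers file not imported here). [folklore] -/
private theorem secondCountable_SU : SecondCountableTopology (Matrix.specialUnitaryGroup (Fin N) ℂ) := by
  haveI := secondCountableTopology_matrix (n := Fin N)
  exact Topology.IsEmbedding.subtypeVal.secondCountableTopology

/-- ★★ **(E2) FOR `SU(N)` LATTICE YANG–MILLS** (fundamental representation; `β ≥ 0`, every torus): for slots at distinct vertices and any finite family of
group elements whose conjugations annihilate the slot-`i` letter (for `SU(2)` and a traceless letter: `1` and the three unit quaternions),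
`∫ Re tr(word₂ u U p i l) dμ_β = 0`. [cite: Elitzur1975, §II] -/
theorem su_integral_re_trace_word₂_eq_zero {β : ℝ} (hβ : 0 ≤ β) {n : ℕ} (hn : n ≠ 0) (g : Fin n → Matrix.specialUnitaryGroup (Fin N) ℂ)
    (u : PBond P 0 → Matrix (Fin N) (Fin N) ℂ) (p : Plaq P 0) (i l : Fin 4) (hil : (slotBond p i).src ≠ (slotBond p l).src)
    (htw : ∑ k, ((g k)⁻¹ : Matrix.specialUnitaryGroup (Fin N) ℂ).val * u (slotBond p i) * (g k).val = 0) :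
    ∫ U, (word₂ (fundamentalRep (Fin N)) u U p i l).trace.re ∂gibbsMeasure P β = 0 := by
  haveI := secondCountable_SU (N := N)
  refine integral_re_trace_word₂_eq_zero (continuous_fundamentalRep (Fin N)) u hβ hn g p i l hil ?_
  simpa [fundamentalRep] using htw

end SUN

/-! ## §3 The `2 × 2` diagonal mass identity -/

section Mass

variable {P : Params} {j : ℕ} {G : Type} [GaugeGroup G] (ρ : G →* Matrix (Fin 2) (Fin 2) ℂ) (u : PBond P j → Matrix (Fin 2) (Fin 2) ℂ)

omit [GaugeGroup G] in
/-- **Cayley–Hamilton for traceless `2 × 2` matrices**: `X·X = −det X · 1`. [folklore] -/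
theorem mul_self_eq_neg_det_smul (X : Matrix (Fin 2) (Fin 2) ℂ) (h : X.trace = 0) : X * X = -(X.det • (1 : Matrix (Fin 2) (Fin 2) ℂ)) := by
  rw [Matrix.trace_fin_two] at h
  have h11 : X 1 1 = -X 0 0 := by linear_combination h
  ext a b
  fin_cases a <;> fin_cases b <;>
    simp [Matrix.mul_apply, Fin.sum_univ_two, Matrix.det_fin_two, h11] <;> ring

/-- The second insertion of a traceless `2 × 2` letter is a scalar multiple of the plain slot: `slotIns₂_k = (−det u_{b_k}) • slot_k`. [folklore] -/
theorem slotIns₂_eq_smul (U : GaugeField P j G) (p : Plaq P j) (k : Fin 4) (h : (u (slotBond p k)).trace = 0) :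
    slotIns₂ ρ u U p k = (-(u (slotBond p k)).det) • slot ρ U p k := by
  fin_cases k
  · have h' : (u ⟨p.src, p.μ⟩).trace = 0 := by simpa [slotBond] using h
    show u ⟨p.src, p.μ⟩ * (u ⟨p.src, p.μ⟩ * ρ (U ⟨p.src, p.μ⟩)) = (-(u ⟨p.src, p.μ⟩).det) • ρ (U ⟨p.src, p.μ⟩)
    rw [← mul_assoc, mul_self_eq_neg_det_smul _ h', neg_mul, smul_mul_assoc, one_mul, neg_smul]
  · have h' : (u ⟨p.src.shift p.μ, p.ν⟩).trace = 0 := by simpa [slotBond] using h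
    show u ⟨p.src.shift p.μ, p.ν⟩ * (u ⟨p.src.shift p.μ, p.ν⟩ * ρ (U ⟨p.src.shift p.μ, p.ν⟩)) =
      (-(u ⟨p.src.shift p.μ, p.ν⟩).det) • ρ (U ⟨p.src.shift p.μ, p.ν⟩)
    rw [← mul_assoc, mul_self_eq_neg_det_smul _ h', neg_mul, smul_mul_assoc, one_mul, neg_smul]
  · have h' : (u ⟨p.src.shift p.ν, p.μ⟩).trace = 0 := by simpa [slotBond] using h
    show ρ ((U ⟨p.src.shift p.ν, p.μ⟩)⁻¹) * (-u ⟨p.src.shift p.ν, p.μ⟩) * (-u ⟨p.src.shift p.ν, p.μ⟩) =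
      (-(u ⟨p.src.shift p.ν, p.μ⟩).det) • ρ ((U ⟨p.src.shift p.ν, p.μ⟩)⁻¹)
    rw [mul_assoc, neg_mul_neg, mul_self_eq_neg_det_smul _ h', mul_neg, mul_smul_comm, mul_one, neg_smul]
  · have h' : (u ⟨p.src, p.ν⟩).trace = 0 := by simpa [slotBond] using h
    show ρ ((U ⟨p.src, p.ν⟩)⁻¹) * (-u ⟨p.src, p.ν⟩) * (-u ⟨p.src, p.ν⟩) = (-(u ⟨p.src, p.ν⟩).det) • ρ ((U ⟨p.src, p.ν⟩)⁻¹)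
    rw [mul_assoc, neg_mul_neg, mul_self_eq_neg_det_smul _ h', mul_neg, mul_smul_comm, mul_one, neg_smul]

omit [GaugeGroup G] in
/-- Rescaling one slot rescales the word: `word(S[i ↦ c • S i]) = c • word S`. [folklore] -/
theorem word_update_smul_self {N : ℕ} (S : Fin 4 → Matrix (Fin N) (Fin N) ℂ) (i : Fin 4) (c : ℂ) :
    word (Function.update S i (c • S i)) = c • word S := by
  fin_cases i <;> simp [word, Function.update_self, Function.update_of_ne]

/-- ★★ **THE DIAGONAL MASS IDENTITY**: for a traceless `2 × 2` letter, `word₂ ρ u U p i i = (−det u_{b_i}) • ρ(U(∂p))`. [folklore] -/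
theorem word₂_diag_eq_smul (U : GaugeField P j G) (p : Plaq P j) (i : Fin 4) (h : (u (slotBond p i)).trace = 0) :
    word₂ ρ u U p i i = (-(u (slotBond p i)).det) • ρ (GaugeField.plaqHol U p) := by
  unfold word₂
  rw [if_pos rfl, Function.update_idem, slotIns₂_eq_smul ρ u U p i h, word_update_smul_self, rho_plaqHol_eq_word]

/-- ★ `tr word₂ ρ u U p i i = −det(u_{b_i}) · tr ρ(U(∂p))` (traceless `2 × 2` letter): the diagonal second insertions are an exact 1-form MASS TERM against the
plaquette trace. [folklore] -/
theorem trace_word₂_diag (U : GaugeField P j G) (p : Plaq P j) (i : Fin 4) (h : (u (slotBond p i)).trace = 0) :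
    (word₂ ρ u U p i i).trace = -(u (slotBond p i)).det * (ρ (GaugeField.plaqHol U p)).trace := by
  rw [word₂_diag_eq_smul ρ u U p i h, Matrix.trace_smul, smul_eq_mul]

end Mass

/-! ## §4 (E2) for `SU(2)`: the Pauli twirl discharges the family hypothesis -/

section SU2

variable {P : Params}

open Complex
open Summit.QuantumFields.YangMills.Theorems.UnitScaleGibbsElitzurOrthogonality (pauli_twirl_eq_zero quatI_mem quatK_mem star_quat_eq)

/-- ★★★ **ELITZUR ORTHOGONALITY FOR THE DOUBLE-INSERTION WORDS OF `SU(2)` LATTICE YANG–MILLS** (`β ≥ 0`, every torus of Bałaban's `Setup`): if the slot-`i`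
letter `u (slotBond p i)` is traceless and the slot-`l` insertion vertex differs from the slot-`i` one, then `∫ Re tr(word₂ u U p i l) dμ_β = 0` — EXACTLY.
Twirl family `1, 𝐢, 𝐣, 𝐤` (w8's (Q): `X + Σ_q q⁻¹Xq = 2 tr X · 1 = 0`). [cite: Elitzur1975, §II] -/
theorem su2_integral_re_trace_word₂_eq_zero {β : ℝ} (hβ : 0 ≤ β) (u : PBond P 0 → Matrix (Fin 2) (Fin 2) ℂ) (p : Plaq P 0) (i l : Fin 4)
    (hil : (slotBond p i).src ≠ (slotBond p l).src) (hu : (u (slotBond p i)).trace = 0) :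
    ∫ U, (word₂ (fundamentalRep (Fin 2)) u U p i l).trace.re ∂gibbsMeasure P β = 0 := by
  let q : Fin 4 → Matrix.specialUnitaryGroup (Fin 2) ℂ :=
    ![1, ⟨!![I, 0; 0, -I], quatI_mem⟩, ⟨!![(0 : ℂ), 1; -1, 0], FiniteSusceptibilityWeakCoupling.SU2ConjugationEven.J_mem⟩, ⟨!![0, I; I, 0], quatK_mem⟩]
  refine su_integral_re_trace_word₂_eq_zero hβ (n := 4) (by norm_num) q u p i l hil ?_
  obtain ⟨hqI, hqJ, hqK⟩ := star_quat_eq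
  have hinv : ∀ g : Matrix.specialUnitaryGroup (Fin 2) ℂ,
      ((g⁻¹ : Matrix.specialUnitaryGroup (Fin 2) ℂ).val : Matrix (Fin 2) (Fin 2) ℂ) = star g.val := fun g => rfl
  rw [Fin.sum_univ_four]
  simp only [hinv, q, Matrix.cons_val_zero, Matrix.cons_val_one, Matrix.head_cons, Matrix.cons_val_two, Matrix.tail_cons,
    Matrix.cons_val_three, OneMemClass.coe_one, star_one, one_mul, mul_one, hqI, hqJ, hqK]
  have h := pauli_twirl_eq_zero hu
  simp only [neg_mul] at h ⊢
  exact h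

end SU2

end Summit.QuantumFields.YangMills.Theorems.UnitScaleGibbsWordTwoElitzurSU2
end
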